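import Literature.AlgebraicGeometry.Kawanoue2007.IdealisticFiltrationSaturation
import Literature.AlgebraicGeometry.Kawanoue2007.IdealisticFiltrationLocalization
import Literature.AlgebraicGeometry.Kawanoue2007.NonsingularityPrinciple
import Literature.AlgebraicGeometry.Resolution.DiffIdealLocalizationGeneral
import HarnessLib

/-!
# Kawanoue 2007, Part I, Prop. 2.4.2.1 (2): 𝔇-saturation is compatible with localization — PROVED

H. Kawanoue, *Toward resolution of singularities over a field of positive characteristic. Part I. Foundation; the
language of the idealistic filtration*, Publ. RIMS **43** (2007) 819–909 (= arXiv:math/0607009) [Kawanoue2007], §2.4.2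
«Compatibility», **Proposition 2.4.2.1 (2)** and its proof (held arXiv text `lit read paper:arxiv-math-0607009`, chunk
p0073 L1–L24, re-read before typing). Sequel of `IdealisticFiltrationLocalization.lean` (Def. 2.4.1.1 `map` /
`atPrime`, restriction `comap`, Prop. 2.4.2.1 (1) `map_generate`) and `IdealisticFiltrationSaturation.lean` (Def. 2.1.2.1
`IsDSaturated`, `DSat`). PROOF file: theorems only, no definitions, no named facts. Campaign `res-hironaka` (D-0089),
rung LIT-6; it supplies the sentence every Part II statement uses silently — «by compatibility of localization with
𝔇-saturation (cf. 2.4.2 in Part I), the localization `𝕀_P` is also 𝔇-saturated for any closed point `P`»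
(Kawanoue–Matsuki 2010, arXiv:math/0612008 chunk p0041 L25) — so that the LOCAL facts of Part I
(`NonsingularityPrinciple.lean`, filtrations over `R_P`) apply to the localizations `𝕀.atPrime 𝔫` of the GLOBAL
filtrations of Part II (`KawanoueMatsuki2010/InvariantsAtClosedPoint.lean`). Nothing of Hironaka's 2017 manuscript is
referred to or asserted.

## What is proved (faithfulness notes)

* **Prop. 2.4.2.1 (2), localization half** (p0073 L1–L3): «(Compatibility with 𝔇-saturation) Let `𝕀 ⊂ R × ℝ` be an
  idealistic filtration. Then we have `𝔇(𝕀)_S = 𝔇(𝕀_S)`» = `DSat_map_eq_of_isLocalization` (any localization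
  `B = S⁻¹A` of a finitely generated algebra `A` over a field `k`, differential operators over `k`; in print `R` is the
  coordinate ring of an affine open of a nonsingular `W` over `k`, p0072 L3 — regularity is not used), with the two
  halves of the printed proof as separate theorems: «`𝔇(𝕀_S) ∩ {R × ℝ}` is … 𝔇-saturated by Lemma 1.1.2.1 (4)»
  (restriction of operators; any base ring, any localization) = `IsDSaturated.comap_of_isLocalization`, and «`𝔇(𝕀)_S`
  is 𝔇-saturated … by Lemma 1.1.2.1 (7) `Diff^t_{R_S}({𝔇(𝕀)_a}_S) = {Diff^t_R(𝔇(𝕀)_a)}_S`» = `IsDSaturated.map_of_isLocalization`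
  — Lemma 1.1.2.1 (7) being the tree's `Resolution.map_diffIdeal_eq_of_isLocalization` (EGA IV₄ 16.8.6, PROVED in
  `Resolution/DiffIdealLocalizationGeneral.lean` for finite-type algebras over a field), and Lemma 1.1.2.1 (4) the tree's
  `Resolution.diffOpLocalize` (extension of an operator to `S⁻¹A`, EGA IV₄ (16.8.1)). `IsDSaturated` is rephrased
  levelwise through the tree's `Resolution.diffIdeal` (`isDSaturated_iff_diffIdeal_le`). The `𝔇_E` (logarithmic) and
  completion clauses of (2) and all of (3) (ℜ-saturation, r.f.g. type) are NOT treated here.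
* **Consequence (KM 2010, p0041 L25 / Thm. A.1.1.1 proof Step 1, chunk p0057 L13–L17)**: for a 𝔇-saturated `𝕀` over
  the coordinate ring, `𝕀_P` is 𝔇-saturated (`IsDSaturated.atPrime`), hence Part I's Thm. 4.2.1.1 (1) (𝔇-saturated
  form, the FACT `Kawanoue2007_thm_4_2_1_1_generate`) yields «`𝕀_P = G_{R_P}(ℍ)` for any LGS `ℍ` of `𝕀_P`» with
  `μ_ℋ(𝕀_P) = ∞` — the PROVED edge `Kawanoue2007_thm_4_2_1_1_generate.atPrime_eq_generate_of_isLGS` (from the fact;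
  no new fact).

## References

* H. Kawanoue, Publ. RIMS 43 (2007) 819–909 = arXiv:math/0607009: Prop. 2.4.2.1 (2) and proof; Lemma 1.1.2.1 (4)(7);
  Def. 2.1.2.1; Thm. 4.2.1.1 (1). [Kawanoue2007]
* H. Kawanoue, K. Matsuki, Publ. RIMS 46 (2010) = arXiv:math/0612008: Ch. 3 setting p0041 L25; Thm. A.1.1.1, proof
  Step 1. [KawanoueMatsuki2010]
* A. Grothendieck, J. Dieudonné, ÉGA IV₄ (16.8.1), Prop. 16.8.6 (the tree's `diffOpLocalize`,
  `map_diffIdeal_eq_of_isLocalization`). [EGAIV4]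
-/

noncomputable section

namespace Literature.AlgebraicGeometry.Kawanoue2007

namespace IdealisticFiltration

open Literature.AlgebraicGeometry.Resolution

/-! ## `IsDSaturated` levelwise through `Diff^{≤ t}(𝕀_a)` -/

section DiffIdeal

variable {R : Type*} [CommRing R] (k : Type*) [CommRing k] [Algebra k R]

/-- 𝔇-saturation, levelwise: `Diff^{≤ t}_{R/k}(𝕀_a) ⊂ 𝕀_{a−t}` for all `t`, `a` (the tree's `Resolution.diffIdeal` is the
ideal generated by the values of the operators of order `≤ t`). [cite: Kawanoue2007, Def. 2.1.2.1] -/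
theorem isDSaturated_iff_diffIdeal_le (𝕀 : IdealisticFiltration R) :
    IsDSaturated k 𝕀 ↔ ∀ (t : ℕ) (a : ℝ), diffIdeal k t (𝕀.level a) ≤ 𝕀.level (a - t) := by
  simp only [isDSaturated_iff, diffIdeal_le_iff]
  exact ⟨fun h t a D hD f hf => h t D hD a f hf, fun h t D hD a f hf => h t a D hD f hf⟩

/-- Restriction is monotone: `𝕁 ⊂ 𝕁' ⇒ 𝕁 ∩ (R × ℝ) ⊂ 𝕁' ∩ (R × ℝ)`. [cite: Kawanoue2007, Prop. 2.4.2.1 (2), proof] -/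
theorem Incl.comap {S : Type*} [CommRing S] (φ : R →+* S) {𝕁 𝕁' : IdealisticFiltration S} (h : Incl 𝕁 𝕁') :
    Incl (𝕁.comap φ) (𝕁'.comap φ) :=
  fun a => Ideal.comap_mono (h a)

end DiffIdeal

/-! ## The restriction `𝕁 ∩ (R × ℝ)` of a 𝔇-saturated filtration over `S⁻¹A` is 𝔇-saturated (any base ring) -/

section Comap

variable (R₀ : Type*) {A B : Type*} [CommRing R₀] [CommRing A] [CommRing B] [Algebra R₀ A] [Algebra R₀ B]
  [Algebra A B] [IsScalarTower R₀ A B] (S : Submonoid A) [IsLocalization S B]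

include S in
/-- **«`𝔇(𝕀_S) ∩ {R × ℝ}` is … 𝔇-saturated by Lemma 1.1.2.1 (4)»** (p0073 L9): the restriction to `A` of a 𝔇-saturated
filtration over a localization `S⁻¹A` is 𝔇-saturated — an operator `D` of order `≤ t` on `A` extends to `S⁻¹A` with the
same order bound (the tree's `Resolution.diffOpLocalize`, EGA IV₄ (16.8.1)), and `D̃(f/1) = D(f)/1`. Any base ring `R₀`,
any multiplicative set `S`. [cite: Kawanoue2007, Prop. 2.4.2.1 (2), proof; EGAIV4, (16.8.1)] -/
theorem IsDSaturated.comap_of_isLocalization {𝕁 : IdealisticFiltration B} (h𝕁 : IsDSaturated R₀ 𝕁) :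
    IsDSaturated R₀ (𝕁.comap (algebraMap A B)) := by
  intro t D hD a f hf
  rw [mem_level_comap_iff] at hf ⊢
  have hext := isDiffOpLE_diffOpLocalize R₀ B S (hD.isDiffOpOver_comp (B := B))
  have h := h𝕁 t _ hext a _ hf
  rw [diffOpLocalize_algebraMap] at h
  simpa using h

include S in
/-- Hence `𝔇(𝕀)_S ⊂ 𝔇(𝕀_S)` («Firstly …», p0073 L8–L11): `𝔇(𝕀) ⊂ 𝔇(𝕀_S) ∩ {R × ℝ}` by minimality, then extend.
[cite: Kawanoue2007, Prop. 2.4.2.1 (2), proof] -/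
theorem DSat_map_incl_of_isLocalization (𝕀 : IdealisticFiltration A) :
    Incl ((DSat R₀ 𝕀).map (algebraMap A B)) (DSat R₀ (𝕀.map (algebraMap A B))) := by
  rw [map_incl_iff_incl_comap]
  exact DSat_incl R₀ ((incl_comap_map _ 𝕀).trans (Incl.comap _ (incl_DSat R₀ _)))
    ((isDSaturated_DSat R₀ _).comap_of_isLocalization R₀ S)

end Comap

/-! ## The localization of a 𝔇-saturated filtration is 𝔇-saturated (finite type over a field); Prop. 2.4.2.1 (2) -/

section Map

variable (k : Type*) {A B : Type*} [Field k] [CommRing A] [CommRing B] [Algebra k A] [Algebra k B]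
  [Algebra A B] [IsScalarTower k A B] (S : Submonoid A) [IsLocalization S B]

include S in
/-- **«`𝔇(𝕀)_S` is 𝔇-saturated»** (p0073 L12–L18): for `d ∈ Diff^t_{R_S}`,
`d(f) ∈ Diff^t_{R_S}({𝕀_a}_S) = {Diff^t_R(𝕀_a)}_S ⊂ {𝕀_{a−t}}_S` «by Lemma 1.1.2.1 (7)» — here the tree's
`Resolution.map_diffIdeal_eq_of_isLocalization` (`Diff^{≤ t}(I)·S⁻¹A = Diff^{≤ t}(I·S⁻¹A)`, EGA IV₄ 16.8.6, for `A` of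
finite type over the field `k`). So: the localization `𝕀.map (A → S⁻¹A)` of a 𝔇-saturated `𝕀` is 𝔇-saturated.
[cite: Kawanoue2007, Prop. 2.4.2.1 (2), proof; EGAIV4, Prop. 16.8.6] -/
theorem IsDSaturated.map_of_isLocalization [Algebra.FiniteType k A] {𝕀 : IdealisticFiltration A}
    (h𝕀 : IsDSaturated k 𝕀) : IsDSaturated k (𝕀.map (algebraMap A B)) := by
  rw [isDSaturated_iff_diffIdeal_le] at h𝕀 ⊢
  intro t a
  rw [level_map, level_map, ← map_diffIdeal_eq_of_isLocalization k B S t (𝕀.level a)]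
  exact Ideal.map_mono (h𝕀 t a)

include S in
/-- **Prop. 2.4.2.1 (2), localization half: `𝔇(𝕀)_S = 𝔇(𝕀_S)`** — «(Compatibility with 𝔇-saturation) Let
`𝕀 ⊂ R × ℝ` be an idealistic filtration. Then we have `𝔇(𝕀)_S = 𝔇(𝕀_S)`» — for every localization `S⁻¹A` of a
finitely generated algebra `A` over a field `k` (operators over `k`). (`⊂` = `DSat_map_incl_of_isLocalization`, any base;
`⊃` by minimality of `𝔇(𝕀_S)`, since `𝔇(𝕀)_S` is 𝔇-saturated and contains `𝕀_S`.) The `𝔇_E`- and completion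
clauses are not treated. [cite: Kawanoue2007, Prop. 2.4.2.1 (2)] -/
theorem DSat_map_eq_of_isLocalization [Algebra.FiniteType k A] (𝕀 : IdealisticFiltration A) :
    (DSat k 𝕀).map (algebraMap A B) = DSat k (𝕀.map (algebraMap A B)) :=
  Incl.antisymm (DSat_map_incl_of_isLocalization k S 𝕀)
    (DSat_incl k (Incl.map _ (incl_DSat k 𝕀)) ((isDSaturated_DSat k 𝕀).map_of_isLocalization k S))

/-- **«the localization `𝕀_P` is also 𝔇-saturated for any closed point `P`»** (Kawanoue–Matsuki 2010, Ch. 3 setting,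
«by compatibility of localization with 𝔇-saturation (cf. 2.4.2 in Part I)») — for every prime `P` of a finitely
generated algebra over a field. [cite: Kawanoue2007, Prop. 2.4.2.1 (2); KawanoueMatsuki2010, §3 (setting)] -/
theorem IsDSaturated.atPrime [Algebra.FiniteType k A] {𝕀 : IdealisticFiltration A} (h𝕀 : IsDSaturated k 𝕀)
    (P : Ideal A) [P.IsPrime] : IsDSaturated k (𝕀.atPrime P) :=
  h𝕀.map_of_isLocalization k P.primeCompl

/-- Prop. 2.4.2.1 (2) at a prime: `𝔇(𝕀)_P = 𝔇(𝕀_P)`. [cite: Kawanoue2007, Prop. 2.4.2.1 (2)] -/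
theorem DSat_atPrime [Algebra.FiniteType k A] (𝕀 : IdealisticFiltration A) (P : Ideal A) [P.IsPrime] :
    (DSat k 𝕀).atPrime P = DSat k (𝕀.atPrime P) :=
  DSat_map_eq_of_isLocalization k P.primeCompl 𝕀

end Map

end IdealisticFiltration

/-! ## Consequence: Part I's Thm. 4.2.1.1 (1) applies to the localizations of a 𝔇-saturated filtration -/

section NonsingularityAtPrime

open IsLocalRing
open scoped ENNReal

universe u

/-- **KM 2010, Thm. A.1.1.1, proof Step 1 from Part I** (chunk p0057 L13–L17: «we claim `𝕀_P = G_{R_P}(ℍ)` for any LGS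
`ℍ` of `𝕀_P` … we can use the same argument as presented in the proof of the nonsingularity principle formulated in
Chapter 4 of Part I»): under the FACT `Kawanoue2007_thm_4_2_1_1_generate` (Part I Thm. 4.2.1.1 (1), 𝔇-saturated form,
local), for a 𝔇-saturated filtration `𝕀` over a smooth finitely generated `k`-domain `A` (`k` algebraically closed,
`ExpChar k p`), a maximal ideal `𝔫`, and a finite leading generator system `(h, e)` of `𝕀_𝔫 = 𝕀.atPrime 𝔫` with
`μ_ℋ(𝕀_𝔫) = ∞`: `𝕀_𝔫 = G({(h_l, p^{e_l})})`. The localization `𝕀_𝔫` is 𝔇-saturated by Prop. 2.4.2.1 (2)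
(`IsDSaturated.atPrime`, proved above) and an LGS belongs to the class of Rem. 3.1.3.3 (2) (`IsLGS.isWeakLGS`).
[cite: KawanoueMatsuki2010, Thm. A.1.1.1, proof Step 1; Kawanoue2007, Thm. 4.2.1.1 (1), Rem. 4.2.1.2 (4), Prop. 2.4.2.1 (2)] -/
theorem Kawanoue2007_thm_4_2_1_1_generate.atPrime_eq_generate_of_isLGS
    (H : Kawanoue2007_thm_4_2_1_1_generate.{u})
    (p : ℕ) (k : Type u) [Field k] [IsAlgClosed k] [ExpChar k p]
    (A : Type u) [CommRing A] [IsDomain A] [Algebra k A] [Algebra.FiniteType k A] [Algebra.Smooth k A]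
    (𝕀 : IdealisticFiltration A) (hD : IdealisticFiltration.IsDSaturated k 𝕀)
    (𝔫 : Ideal A) [𝔫.IsMaximal] {ι : Type} [Finite ι] (h : ι → Localization.AtPrime 𝔫) (e : ι → ℕ)
    (hH : IsLGS p (𝕀.atPrime 𝔫) h e) (hμ : muTilde (𝕀.atPrime 𝔫) h = ⊤) :
    𝕀.atPrime 𝔫 = IdealisticFiltration.generate (Set.range fun l => (h l, ((p ^ e l : ℕ) : ℝ))) :=
  H p k A 𝔫 (𝕀.atPrime 𝔫) (hD.atPrime k 𝔫) h e hH.isWeakLGS hμ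

end NonsingularityAtPrime

end Literature.AlgebraicGeometry.Kawanoue2007

end
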